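import Literature.Analysis.UnboundedOperators.ClosableForm
import Mathlib.Analysis.Normed.Operator.Compact.Basic
import Mathlib.Analysis.InnerProductSpace.Continuous
import HarnessLib

/-!
# Closability criteria for symmetric forms over `ℝ` or `ℂ`, and compactness of the closure's embedding

`Literature.Analysis.UnboundedOperators.ClosableForm` sets up Kato's completed form domain over
`ℂ`: a nonnegative symmetric form `𝔥` on a core is recorded as an inner product space `V` (the
core with `⟪f, g⟫_V = (𝔥 + 1)[f, g]`) with the inclusion `ι : V →L H`, the closure lives on
`UniformSpace.Completion V`, embedded into `H` by `formEmbedding ι = ι.extend toComplL`, and the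
form is closable iff this map is injective (Kato VI Thm 1.17).

This file states the same facts over an arbitrary `RCLike` field `𝕜` (so that REAL Schrödinger
forms can use them), for the raw extension `ι.extend (Completion.toComplL : V →L[𝕜] Completion V)`
(which for `𝕜 = ℂ` is `formEmbedding ι` by definition, `formEmbedding_eq_extend`), and adds the
two criteria that are used in practice:

* `extend_toComplL_injective_iff` — Kato VI Thm 1.17: injective iff every `𝔥`-Cauchy sequence of
  the core tending to `0` in `H` tends to `0` in `𝔥`-norm;
* `extend_toComplL_injective_of_norm_le_of_tendsto` — lower semicontinuity ⟹ closable
  (Kato VI Thms 1.16–1.17);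
* `extend_toComplL_injective_of_inner_eq` — **Kato VI Thm 1.27 / Cor 1.28: the form of a
  symmetric operator bounded from below is closable**: if `⟪f, g⟫_V = ⟪S f, ι g⟫_H + ⟪ι f, ι g⟫_H`
  for some map `S : V → H` (i.e. `𝔥[f, g] = (S f, g)`), the embedding of the completion is
  injective;
* `isCompactOperator_extend_toComplL` — if `ι` maps `𝔥`-bounded subsets of the core to totally
  bounded subsets of `H` (Rellich's criterion on the core, e.g.
  `Literature.Analysis.FunctionSpaces.totallyBounded_Lp_of_confining`), the embedding of the
  completed form domain is a compact operator (Reed–Simon IV, Thm XIII.64 (iv): the form-norm unit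
  ball is relatively compact in `H`);
* `denseRange_extend_toComplL` — dense core ⟹ dense range.

With `J := ι.extend toComplL` injective, compact and of dense range,
`Literature.Analysis.OperatorTheory.exists_hilbertBasis_form_hasSum J` (any `RCLike 𝕜`) yields the
orthonormal basis of form-eigenvectors with eigenvalues `→ ∞`.

No definitions, no named facts, no instances, no notation.

## References
* [Kato1966] T. Kato, *Perturbation Theory for Linear Operators* (1966), VI §1.3 Thm 1.11, §1.4
  Thms 1.16–1.17 (held p0369–p0372), §1.5 Thm 1.27 and Cor 1.28 («A symmetric operator bounded
  from below is form-closable», held p0374).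
* [ReedSimonIV1978] M. Reed, B. Simon, *Methods of Modern Mathematical Physics IV*, §XIII.14,
  Thm XIII.64 (compact resolvent ⇔ form-norm balls relatively compact), p. 245 (held p0231–p0232).
-/

noncomputable section

open UniformSpace Filter _root_.Topology

namespace Literature.Analysis.UnboundedOperators

section Complex

variable {V' : Type*} [NormedAddCommGroup V'] [InnerProductSpace ℂ V']
variable {H' : Type*} [NormedAddCommGroup H'] [InnerProductSpace ℂ H'] [CompleteSpace H']

/-- Over `ℂ`, `formEmbedding ι` IS the raw extension `ι.extend toComplL` treated in this file.
[cite: Kato1966, VI §1.4 Thm 1.17 (the closure `t̃` on the completion `H_t̃`), held p0371] -/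
theorem formEmbedding_eq_extend (ι : V' →L[ℂ] H') :
    formEmbedding ι = ι.extend (Completion.toComplL : V' →L[ℂ] Completion V') := rfl

end Complex

variable {𝕜 : Type*} [RCLike 𝕜]
variable {V : Type*} [NormedAddCommGroup V] [InnerProductSpace 𝕜 V]
variable {H : Type*} [NormedAddCommGroup H] [InnerProductSpace 𝕜 H] [CompleteSpace H]

omit [InnerProductSpace 𝕜 V] in
/-- `V → Completion V` has dense range (plumbing). [folklore] -/
private theorem denseRange_toComplL' [NormedSpace 𝕜 V] :
    DenseRange (Completion.toComplL : V →L[𝕜] Completion V) := by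
  rw [Completion.coe_toComplL]; exact Completion.denseRange_coe

omit [InnerProductSpace 𝕜 V] in
/-- `V → Completion V` is uniformly inducing (plumbing). [folklore] -/
private theorem isUniformInducing_toComplL' [NormedSpace 𝕜 V] :
    IsUniformInducing (Completion.toComplL : V →L[𝕜] Completion V) := by
  rw [Completion.coe_toComplL]; exact Completion.isUniformInducing_coe V

variable (ι : V →L[𝕜] H)

/-- The extension agrees with `ι` on the core. [cite: Kato1966, VI §1.4 Thm 1.17 («`t̃ ⊃ t`»), held p0371] -/
@[simp] theorem extend_toComplL_coe (f : V) :
    ι.extend (Completion.toComplL : V →L[𝕜] Completion V) (f : Completion V) = ι f := by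
  have h := ContinuousLinearMap.extend_eq ι denseRange_toComplL' isUniformInducing_toComplL' f
  rwa [Completion.coe_toComplL] at h

/-- Dense core ⟹ the extension has dense range. [cite: Kato1966, VI §1.4 (densely defined forms), held p0371] -/
theorem denseRange_extend_toComplL (hι : DenseRange ι) :
    DenseRange (ι.extend (Completion.toComplL : V →L[𝕜] Completion V)) := by
  refine hι.mono ?_
  rintro _ ⟨f, rfl⟩
  exact ⟨(f : Completion V), extend_toComplL_coe ι f⟩

/-- **Kato VI Thm 1.17 over `𝕜`**: the extension `J` of `ι` to the completed form domain is
injective iff every `𝔥`-Cauchy sequence of the core with `ι u_n → 0` in `H` has `‖u_n‖_𝔥 → 0`.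
[cite: Kato1966, VI §1.4 Thm 1.17 («t is closable if and only if `u_n →_t 0` implies `t[u_n] → 0`»), held p0371] -/
theorem extend_toComplL_injective_iff :
    Function.Injective (ι.extend (Completion.toComplL : V →L[𝕜] Completion V)) ↔
      ∀ u : ℕ → V, CauchySeq u → Tendsto (fun n ↦ ι (u n)) atTop (𝓝 0) →
        Tendsto (fun n ↦ ‖u n‖) atTop (𝓝 0) := by
  set J := ι.extend (Completion.toComplL : V →L[𝕜] Completion V) with hJ
  constructor
  · intro hinj u hu h0
    have hc : CauchySeq (fun n ↦ (u n : Completion V)) :=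
      (Completion.uniformContinuous_coe V).comp_cauchySeq hu
    obtain ⟨x, hx⟩ := cauchySeq_tendsto_of_complete hc
    have hJx : Tendsto (fun n ↦ J (u n : Completion V)) atTop (𝓝 (J x)) :=
      (J.continuous.tendsto x).comp hx
    simp only [hJ, extend_toComplL_coe] at hJx
    have hx0 : x = 0 := hinj (by rw [tendsto_nhds_unique hJx h0, map_zero])
    rw [hx0] at hx
    have := (continuous_norm.tendsto (0 : Completion V)).comp hx
    simpa [Function.comp_def, Completion.norm_coe] using this
  · intro hcl
    refine (injective_iff_map_eq_zero _).2 fun x hx ↦ ?_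
    have hxc : x ∈ closure (Set.range ((↑) : V → Completion V)) := by
      rw [Completion.denseRange_coe.closure_range]; exact Set.mem_univ x
    obtain ⟨s, hs, hsx⟩ := mem_closure_iff_seq_limit.1 hxc
    choose u hu using hs
    have hsu : (fun n ↦ (u n : Completion V)) = s := funext hu
    have hu_c : CauchySeq u := by
      have h1 : CauchySeq s := hsx.cauchySeq
      rw [← hsu] at h1
      have h2 : Cauchy (map ((↑) : V → Completion V) (map u atTop)) := by
        rw [Filter.map_map]; exact h1
      exact (Completion.isUniformInducing_coe V).cauchy_map_iff.1 h2
    have hu0 : Tendsto (fun n ↦ ι (u n)) atTop (𝓝 0) := by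
      have hJx : Tendsto (fun n ↦ J (s n)) atTop (𝓝 (J x)) := (J.continuous.tendsto x).comp hsx
      rw [hx] at hJx
      refine hJx.congr fun n ↦ ?_
      rw [← hu n, hJ, extend_toComplL_coe]
    have hn := hcl u hu_c hu0
    have hs0 : Tendsto s atTop (𝓝 0) := by
      rw [tendsto_zero_iff_norm_tendsto_zero]
      refine hn.congr fun n ↦ ?_
      rw [← hu n, Completion.norm_coe]
    exact tendsto_nhds_unique hsx hs0

/-- **Lower semicontinuity ⟹ closability** over `𝕜` (Kato VI Thms 1.16–1.17): if `ι u_n → ι f`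
with `‖u_n‖_𝔥 ≤ C` forces `‖f‖_𝔥 ≤ C` (all in the core), the extension is injective.
[cite: Kato1966, VI §1.4 Thm 1.16 and Thm 1.17, held p0370–p0371] -/
theorem extend_toComplL_injective_of_norm_le_of_tendsto
    (hlsc : ∀ (u : ℕ → V) (f : V) (C : ℝ), Tendsto (fun n ↦ ι (u n)) atTop (𝓝 (ι f)) →
      (∀ n, ‖u n‖ ≤ C) → ‖f‖ ≤ C) :
    Function.Injective (ι.extend (Completion.toComplL : V →L[𝕜] Completion V)) := by
  rw [extend_toComplL_injective_iff]
  intro u hu h0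
  rw [Metric.tendsto_atTop]
  intro ε hε
  obtain ⟨N, hN⟩ := Metric.cauchySeq_iff.1 hu (ε / 2) (half_pos hε)
  refine ⟨N, fun m hm ↦ ?_⟩
  have ht : Tendsto (fun n ↦ ι (u m - u (n + N))) atTop (𝓝 (ι (u m))) := by
    have h1 : Tendsto (fun n ↦ ι (u (n + N))) atTop (𝓝 0) := h0.comp (tendsto_add_atTop_nat N)
    have h2 := (tendsto_const_nhds (x := ι (u m))).sub h1
    rw [sub_zero] at h2
    refine h2.congr fun n ↦ ?_
    rw [map_sub]
  have hb : ∀ n, ‖u m - u (n + N)‖ ≤ ε / 2 := fun n ↦ by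
    have := hN m hm (n + N) (Nat.le_add_left N n)
    rw [dist_eq_norm] at this
    exact this.le
  have hm' := hlsc (fun n ↦ u m - u (n + N)) (u m) (ε / 2) ht hb
  rw [dist_zero_right, norm_norm]
  linarith

open scoped InnerProductSpace in
/-- **Kato VI Thm 1.27 / Cor 1.28 over `𝕜`: the form of a symmetric operator bounded from below is
closable.** In the `(V, ι)` format: if the inner product of the core is
`⟪f, g⟫_V = ⟪S f, ι g⟫_H + ⟪ι f, ι g⟫_H` for some map `S : V → H` (so `𝔥[f, g] = (S f, g)` with
`𝔥 ≥ 0`), then the extension of `ι` to the completion is injective.  Kato's proof: for a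
`𝔥`-Cauchy sequence `u_n` with `ι u_n → 0`,
`‖u_n‖² = ⟪u_n, u_n - u_m⟫ + (S u_n, ι u_m) + (ι u_n, ι u_m) ≤ M ε + o(1)` as `m → ∞`.
[cite: Kato1966, VI §1.5 Thm 1.27 and Cor 1.28 («A symmetric operator bounded from below is form-closable»), held p0374] -/
theorem extend_toComplL_injective_of_inner_eq (S : V → H)
    (hS : ∀ f g : V, ⟪f, g⟫_𝕜 = ⟪S f, ι g⟫_𝕜 + ⟪ι f, ι g⟫_𝕜) :
    Function.Injective (ι.extend (Completion.toComplL : V →L[𝕜] Completion V)) := by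
  rw [extend_toComplL_injective_iff]
  intro u hu h0
  -- the sequence is bounded
  obtain ⟨R, hR0, hR⟩ := cauchySeq_bdd hu
  set K : ℝ := R + ‖u 0‖ with hK
  have hKn : ∀ n, ‖u n‖ ≤ K := fun n ↦ by
    have h1 := hR n 0
    rw [dist_eq_norm] at h1
    calc ‖u n‖ = ‖(u n - u 0) + u 0‖ := by rw [sub_add_cancel]
      _ ≤ ‖u n - u 0‖ + ‖u 0‖ := norm_add_le _ _
      _ ≤ R + ‖u 0‖ := by linarith
  have hK0 : 0 ≤ K := (norm_nonneg _).trans (hKn 0)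
  -- `⟪u n, u m⟫_V → 0` as `m → ∞`, for each fixed `n`
  have hlim : ∀ n, Tendsto (fun m ↦ ⟪u n, u m⟫_𝕜) atTop (𝓝 0) := by
    intro n
    have h1 : Tendsto (fun m ↦ ⟪S (u n), ι (u m)⟫_𝕜 + ⟪ι (u n), ι (u m)⟫_𝕜) atTop
        (𝓝 (⟪S (u n), (0 : H)⟫_𝕜 + ⟪ι (u n), (0 : H)⟫_𝕜)) :=
      (tendsto_const_nhds.inner h0).add (tendsto_const_nhds.inner h0)
    rw [inner_zero_right, inner_zero_right, add_zero] at h1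
    exact h1.congr fun m ↦ (hS (u n) (u m)).symm
  -- conclusion
  rw [Metric.tendsto_atTop]
  intro ε hε
  set δ : ℝ := ε ^ 2 / (2 * (K + 1)) with hδ
  have hδ0 : 0 < δ := by positivity
  obtain ⟨N, hN⟩ := Metric.cauchySeq_iff.1 hu δ hδ0
  refine ⟨N, fun n hn ↦ ?_⟩
  rw [dist_zero_right, norm_norm]
  have hsq : ‖u n‖ ^ 2 ≤ K * δ := by
    have hT : Tendsto (fun m ↦ K * δ + ‖⟪u n, u m⟫_𝕜‖) atTop (𝓝 (K * δ + ‖(0 : 𝕜)‖)) :=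
      tendsto_const_nhds.add (hlim n).norm
    rw [norm_zero, add_zero] at hT
    refine ge_of_tendsto hT (eventually_atTop.2 ⟨N, fun m hm ↦ ?_⟩)
    have e : ‖u n‖ ^ 2 = RCLike.re ⟪u n, u n - u m⟫_𝕜 + RCLike.re ⟪u n, u m⟫_𝕜 := by
      rw [← map_add, ← inner_add_right, sub_add_cancel, inner_self_eq_norm_sq]
    have h1 : RCLike.re ⟪u n, u n - u m⟫_𝕜 ≤ K * δ :=
      calc RCLike.re ⟪u n, u n - u m⟫_𝕜 ≤ ‖⟪u n, u n - u m⟫_𝕜‖ := RCLike.re_le_norm _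
        _ ≤ ‖u n‖ * ‖u n - u m‖ := norm_inner_le_norm _ _
        _ ≤ K * δ := by
            have hd := hN n hn m hm
            rw [dist_eq_norm] at hd
            exact mul_le_mul (hKn n) hd.le (norm_nonneg _) hK0
    have h2 : RCLike.re ⟪u n, u m⟫_𝕜 ≤ ‖⟪u n, u m⟫_𝕜‖ := RCLike.re_le_norm _
    linarith
  have hKδ : K * δ < ε ^ 2 := by
    rw [hδ]
    have h1 : K * (ε ^ 2 / (2 * (K + 1))) = ε ^ 2 * (K / (2 * (K + 1))) := by ring
    rw [h1]
    have h2 : K / (2 * (K + 1)) < 1 := by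
      rw [div_lt_one (by positivity)]; linarith
    have h3 : 0 < ε ^ 2 := by positivity
    nlinarith
  by_contra hcon
  push Not at hcon
  have : ε ^ 2 ≤ ‖u n‖ ^ 2 := pow_le_pow_left₀ hε.le hcon 2
  linarith

/-- **Compactness of the embedding of the completed form domain** (the input (iv) of Reed–Simon IV,
Thm XIII.64: form-norm balls relatively compact in `H`): if `ι` maps every `𝔥`-norm ball of the
core onto a totally bounded subset of `H`, then the extension `J` of `ι` to the completion is a
compact operator (`J` maps the unit ball into the closure of `ι (2·ball)`).
[cite: ReedSimonIV1978, Thm. XIII.64 (iv) (§XIII.14, p. 245); Kato1966, VI §1.3 Thm 1.11 (density of the core in `H_t̃`), held p0369] -/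
theorem isCompactOperator_extend_toComplL
    (htb : ∀ r : ℝ, TotallyBounded (ι '' Metric.closedBall (0 : V) r)) :
    IsCompactOperator (ι.extend (Completion.toComplL : V →L[𝕜] Completion V)) := by
  set J := ι.extend (Completion.toComplL : V →L[𝕜] Completion V) with hJ
  rw [isCompactOperator_iff_exists_mem_nhds_image_subset_compact]
  refine ⟨Metric.closedBall 0 1, Metric.closedBall_mem_nhds _ one_pos,
    closure (ι '' Metric.closedBall (0 : V) 2),
    (htb 2).closure.isCompact_of_isClosed isClosed_closure, ?_⟩
  rintro _ ⟨x, hx, rfl⟩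
  rw [Metric.mem_closedBall, dist_zero_right] at hx
  -- approximate `x` by core elements
  have hxc : x ∈ closure (Set.range ((↑) : V → Completion V)) := by
    rw [Completion.denseRange_coe.closure_range]; exact Set.mem_univ x
  obtain ⟨s, hs, hsx⟩ := mem_closure_iff_seq_limit.1 hxc
  choose u hu using hs
  have hJx : Tendsto (fun n ↦ J (s n)) atTop (𝓝 (J x)) := (J.continuous.tendsto x).comp hsx
  have hnorm : Tendsto (fun n ↦ ‖u n‖) atTop (𝓝 ‖x‖) := by
    have := hsx.norm
    refine this.congr fun n ↦ ?_
    rw [← hu n, Completion.norm_coe]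
  have hev : ∀ᶠ n in atTop, ‖u n‖ < 2 :=
    hnorm.eventually (eventually_lt_nhds (show ‖x‖ < 2 by linarith))
  refine mem_closure_of_tendsto hJx (hev.mono fun n hn ↦ ?_)
  refine ⟨u n, ?_, ?_⟩
  · rw [Metric.mem_closedBall, dist_zero_right]; exact hn.le
  · rw [← hu n, hJ, extend_toComplL_coe]

end Literature.Analysis.UnboundedOperators

end
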